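import Summits.ResolutionOfSingularities.ResolutionOfSingularities.Theorems.FrobeniusClosingSteerK7HatCentreCurve
import Summits.ResolutionOfSingularities.ResolutionOfSingularities.Theorems.FrobeniusClosingSteerK7HatBranches
import Summits.ResolutionOfSingularities.ResolutionOfSingularities.Theorems.FrobeniusClosingSteerK7HatSquareDatum
import Literature.AlgebraicGeometry.Resolution.RegularHomLocalization
import HarnessLib

/-!
# Crux `Steer` (stmt-ResolutionOfSingularities-16345), chain W4.1 — K-β7-hat W1: `branchTransfer_holds : K7Hat.BranchTransfer` (FILE 6, assembly)

OURS (campaign `res-hironaka`, rung L ★L-G4, slot W4.1; res-L0-w41-idea-3 g12, object of record W1 by res-L0-w41-plan-1 RULINGS 237(b)/242(c)/256(b);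
plan `L/res-L0-w41-idea-3/k7w1/W1-PLAN.md` bc52383b129f540e). PROVES the tree word `…Theorems.SwitchingDichotomy.K7Hat.BranchTransfer` (res-D-pv-035,
p555432) — the W1 crux piece of the K-β7-hat exit (β-leaf binder `hT` of `K7Hat.formalCentreDescent_of`). Replaces the role of no printed item; NOT a
statement of the manuscript under review [claim: Hironaka2017, status: under-review]; AI-produced, weaker than expert review; counted 0.

ASSEMBLY (W1-PLAN §1 (T)) over an abstract hat `ι : S → T` with frame `e : T ≅ Ŝ` over `S`, `S` regular local excellent of dimension `4` and
characteristic `2`, `P₁ = (ι x, z′, w′)`, `Q₀ = P₁ ∩ S`, `F + q² ∈ P₁^d`, `d ≥ 2`: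
* `S → T` is a REGULAR homomorphism: `S → Ŝ` is (G-ring, tree `IsGRing.isRegularHom_adicCompletion`), transported along the `S`-isomorphism `e`
  (tree `IsRegularHom.of_algEquiv`); `P₁` is prime, `ι y ∉ P₁`, `dim T/P₁ = 1` (res-D-pv-035ʼs `K7HatBranchConclusion.hatCoordinates_core`, p556662);
* (C) `dim S/Q₀ = 1` — FILE 3 `K7HatCentreCurve.ringKrullDim_quotient_under_eq_one` (p559076; uses FILE 1 p557918 (G1) and FILE 2 p557552 (G2)) with
  the «no singular surface» clause;
* (iii)+(ii) the minimal primes of `Q₀T` contract to `Q₀` and have dimension `1`, and `P₁` is one of them — FILE 4 `K7HatBranches.minimalPrimes_map_contract`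
  / `mem_minimalPrimes_of_dim_one` (res-D-pv-035);
* (i) `Q₀T` is radical — tree `IsGRing.isRadical_map_adicCompletion`, transported along `e`;
* (iv) the square datum — FILE 5 `K7HatSquareDatum.exists_sq_datum` (res-D-pv-028; uses FILE 1ʼs COR B and the tree `SquareDescent`).
[cite: Matsumura1987, Thm. 8.14, Thm. 14.2, Thm. 23.7, §32 p. 256, p. 260] [folklore]
bears_on: LADDER-RESOLUTION L ★L-G4 W4.1 (crux `Steer`, β-leaf binder hβ6′ `FormalCentreDescent`, crux piece W1 `BranchTransfer`).
-/

noncomputable section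

set_option linter.dupNamespace false
set_option autoImplicit false

open IsLocalRing Polynomial


namespace Summit.ResolutionOfSingularities.ResolutionOfSingularities.Theorems.SwitchingDichotomy.K7HatBranchTransfer

open Literature.AlgebraicGeometry.Resolution
open Summit.ResolutionOfSingularities.ResolutionOfSingularities.Theorems.SwitchingDichotomy
open Summit.ResolutionOfSingularities.ResolutionOfSingularities.Theorems.SwitchingDichotomy.K7Hat

/-- Along `ι` with `𝔪_S T = 𝔪_T`, units pull back to units. [folklore] -/
theorem isLocalHom_of_map_maximalIdeal_eq {S T : Type} [CommRing S] [IsLocalRing S] [CommRing T] [IsLocalRing T]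
    (ι : S →+* T) (hmax : (maximalIdeal S).map ι = maximalIdeal T) : IsLocalHom ι := by
  refine ⟨fun a ha => ?_⟩
  by_contra hna
  have hmem : ι a ∈ maximalIdeal T := hmax ▸ Ideal.mem_map_of_mem ι ((IsLocalRing.mem_maximalIdeal a).mpr hna)
  exact (IsLocalRing.mem_maximalIdeal (ι a)).mp hmem ha

/-- **W1 over an abstract hat (core form).** See the module docstring; `F` is the radicand and `hNS` the «no singular surface» clause UNFOLDED
(`IsSingPrime`, `RadicandRing`). [cite: Matsumura1987, Thm. 14.2, Thm. 23.7, §32] -/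
theorem branchTransfer_core {S T : Type} [CommRing S] [IsLocalRing S] [CharP S 2] [CommRing T] [IsLocalRing T]
    (ι : S →+* T) (e : T ≃+* AdicCompletion (maximalIdeal S) S)
    (x y z w : S) (d : ℕ) (z' w' q : T) (F : S)
    (hreg : IsRegularLocalRing S) (hdim : ringKrullDim S = 4) (hexc : IsExcellentRing S) (hhat : IsHatOf ι)
    (he : ∀ a : S, e (ι a) = algebraMap S (AdicCompletion (maximalIdeal S) S) a)
    (hNS : ∀ (Q : Ideal S) [Q.IsPrime],
      ¬ IsRegularLocalRing (AdjoinRoot (X ^ 2 - C (algebraMap S (Localization.AtPrime Q) F))) → ringKrullDim (S ⧸ Q) ≤ 1)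
    (hspan : Ideal.span {x, y, z, w} = maximalIdeal S) (hd : 2 ≤ d)
    (hz : z' - ι z ∈ (Ideal.span {x, y}).map ι) (hw : w' - ι w ∈ (Ideal.span {x, y}).map ι)
    (hsq : ι F + q ^ 2 ∈ Ideal.span {ι x, z', w'} ^ d) :
    (Ideal.map ι ((Ideal.span {ι x, z', w'}).comap ι)).IsRadical ∧
    Ideal.span {ι x, z', w'} ∈ (Ideal.map ι ((Ideal.span {ι x, z', w'}).comap ι)).minimalPrimes ∧
    (∀ P ∈ (Ideal.map ι ((Ideal.span {ι x, z', w'}).comap ι)).minimalPrimes,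
      P.comap ι = (Ideal.span {ι x, z', w'}).comap ι ∧ ringKrullDim (T ⧸ P) = 1) ∧
    ∃ u r : S, u ∉ (Ideal.span {ι x, z', w'}).comap ι ∧
      u ^ 2 * F + r ^ 2 ∈ (Ideal.span {ι x, z', w'}).comap ι ^ d := by
  classical
  haveI := hreg
  letI : Algebra S T := ι.toAlgebra
  have hιalg : algebraMap S T = ι := rfl
  -- ### the frame facts (res-D-pv-035ʼs S0)
  obtain ⟨hTreg, hTdim, hmaxT, hP₁, hTP₁reg, hdimP₁⟩ :=
    K7HatBranchConclusion.hatCoordinates_holds S T ι e x y z w z' w' hreg hdim hhat he hspan hz hw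
  obtain ⟨-, -, -, -, -, -, -, hyP₁, -, -⟩ :=
    K7HatBranchConclusion.hatCoordinates_core ι e x y z w z' w' hreg hdim hhat.2.2.1 he hspan hz hw
  haveI := hP₁
  haveI : IsNoetherianRing T := hhat.1
  haveI : IsLocalHom (algebraMap S T) := isLocalHom_of_map_maximalIdeal_eq ι hhat.2.2.1
  have hmax : (maximalIdeal S).map (algebraMap S T) = maximalIdeal T := hhat.2.2.1
  -- ### `S → T` is a regular homomorphism (G-ring + transport along the frame)
  have hG : IsGRing S := hexc.2.1
  have hι : ι = (e.symm : AdicCompletion (maximalIdeal S) S →+* T).comp (algebraMap S (AdicCompletion (maximalIdeal S) S)) := by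
    refine RingHom.ext fun a => ?_
    rw [RingHom.comp_apply, RingHom.coe_coe, ← he a, RingEquiv.symm_apply_apply]
  let eA : AdicCompletion (maximalIdeal S) S ≃ₐ[S] T :=
    AlgEquiv.ofRingEquiv (f := e.symm) fun a => by
      rw [hιalg, ← he a, RingEquiv.symm_apply_apply]
  have hRH : IsRegularHom S T := IsRegularHom.of_algEquiv eA hG.isRegularHom_adicCompletion
  haveI : Module.Flat S T := hRH.1
  -- ### (C) the contracted centre `Q₀ = P₁ ∩ S` is a curve
  have hy : y ∈ maximalIdeal S := hspan ▸ Ideal.subset_span (by simp)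
  have hF2 : algebraMap S T F + q ^ 2 ∈ Ideal.span {ι x, z', w'} ^ 2 := Ideal.pow_le_pow_right hd hsq
  have hQ₀ : ringKrullDim (S ⧸ (Ideal.span {ι x, z', w'}).under S) = 1 :=
    K7HatCentreCurve.ringKrullDim_quotient_under_eq_one hreg hRH (Ideal.span {ι x, z', w'}) y F q hy hyP₁ hF2 hNS
  have hunder : (Ideal.span {ι x, z', w'}).under S = (Ideal.span {ι x, z', w'}).comap ι := rfl
  -- ### (iii) the formal branches contract to `Q₀` and are curves; (ii) `P₁` is one of them
  have hiii : ∀ P ∈ (Ideal.map ι ((Ideal.span {ι x, z', w'}).comap ι)).minimalPrimes,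
      P.comap ι = (Ideal.span {ι x, z', w'}).comap ι ∧ ringKrullDim (T ⧸ P) = 1 :=
    K7HatBranches.minimalPrimes_map_contract (S := S) (T := T) hmax ((Ideal.span {ι x, z', w'}).under S) hQ₀
  have hii : Ideal.span {ι x, z', w'} ∈ (Ideal.map ι ((Ideal.span {ι x, z', w'}).comap ι)).minimalPrimes :=
    K7HatBranches.mem_minimalPrimes_of_dim_one _ _ Ideal.map_comap_le hdimP₁ fun P' hP' => (hiii P' hP').2
  -- ### (i) `Q₀T` is radical (G-ring, transported along the frame)
  have hi : (Ideal.map ι ((Ideal.span {ι x, z', w'}).comap ι)).IsRadical := by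
    have hrad := IsGRing.isRadical_map_adicCompletion hG ((Ideal.span {ι x, z', w'}).under S)
    rw [hunder] at hrad
    have hmapeq : Ideal.map ι ((Ideal.span {ι x, z', w'}).comap ι) =
        (((Ideal.span {ι x, z', w'}).comap ι).map (algebraMap S (AdicCompletion (maximalIdeal S) S))).comap e := by
      have h1 : Ideal.map ι ((Ideal.span {ι x, z', w'}).comap ι) =
          (((Ideal.span {ι x, z', w'}).comap ι).map (algebraMap S (AdicCompletion (maximalIdeal S) S))).map
            (e.symm : AdicCompletion (maximalIdeal S) S →+* T) := by
        rw [Ideal.map_map, ← hι]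
      rw [h1, Ideal.map_comap_of_equiv, RingEquiv.symm_symm]
    rw [hmapeq]
    exact hrad.comap _
  -- ### (iv) the square datum
  have hiv : ∃ u r : S, u ∉ (Ideal.span {ι x, z', w'}).comap ι ∧
      u ^ 2 * F + r ^ 2 ∈ (Ideal.span {ι x, z', w'}).comap ι ^ d :=
    K7HatSquareDatum.exists_sq_datum hreg hRH (Ideal.span {ι x, z', w'}) hi hii F q d hsq
  exact ⟨hi, hii, hiii, hiv⟩

/-- **W1 `BranchTransfer` HOLDS.** Instantiate `branchTransfer_core` at `S = R i`, `F = s i ^ 2`, the «no singular surface» clause being the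
tree word `HevLeaf.NoSingularSurfaceAt R s 2 i` unfolded. OURS. [cite: Matsumura1987, Thm. 14.2, Thm. 23.7, §32] -/
theorem branchTransfer_holds : BranchTransfer := by
  intro K _ _ R s i hloc hs T _ _ ι e x y z w d z' w' q hreg hdim hexc hhat he hNSS hspan hd hz hw hsq
  exact branchTransfer_core ι e x y z w d z' w' q ⟨s i ^ 2, hs⟩ hreg hdim hexc hhat he (fun Q _ h => hNSS hs Q h) hspan hd hz hw hsq

end Summit.ResolutionOfSingularities.ResolutionOfSingularities.Theorems.SwitchingDichotomy.K7HatBranchTransfer
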